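import Literature.MathematicalPhysics.QuantumFieldTheory.Balaban1983to89.Step
import Literature.MathematicalPhysics.QuantumFieldTheory.Balaban1983to89.B12

/-!
# `Balaban1983to89.B12Form13Step268` — [Balaban1987RG1] p. 268 (and p. 256): the form (1.3) advances by one step

CITATION HEADER (lean-in-tree rule 2026-08-18).  T. Bałaban, *Renormalization group approach to lattice gauge field
theories. I. Generation of effective actions in a small field approximation and a coupling constant renormalization in
four dimensions*, Commun. Math. Phys. **109** (1987) 249–301 [Balaban1987RG1]; PDF page = journal page − 248 (PDF held:
`paper:balaban1987-cmp109-rg-i-small-field`; renders `…-p008-x2.png`, `…-p020-x2.png` read first-hand, unit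
`lit-balaban-r09` gen 40, rows B12.Eq2.15 / B12.Eq0.22-0.23 of `HOME/lit-balaban-r09/ROWS-B12.md`).
v1.1 (gen 41, DOCSTRING-ONLY; referee lit-balaban-ref-1 g83 F1): the p. 256 quotations now carry print's superscripts
`A^{L⁻¹}`, `A^η(U_k)`, `𝐄^{(j)}(U_k)` (re-read on `…-p008-x2.png`); declarations byte-identical to v1.0.
NORMALISATION (ours, said once): print's superscript on the Wilson action (`A^{L⁻¹}` after the first step, `A^η` after `k`
steps, `η = L^{−k}`) is the lattice spacing entering (0.2) `A^ε(U) = Σ_p ε^{d−4}[1 − Re tr U(∂p)]` through the weight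
`ε^{d−4}`; in `d = 4` that weight is `1` and the tree's `wilsonAction4 = wilsonAction 1` carries no superscript, so outside
quotation marks this file writes plain `A`, `A(U)` for print's `A^{L⁻¹}`, `A^η(U_k)`.
Statement-level skeleton of published theorems with citation tags; proofs where landed; nothing here is a claim about
the Yang–Mills mass gap.

WHAT IS PROVED (kernel-checked ALGEBRA on the tree's forms (1.3) `Step.SFTower.action13`, (1.6)/(0.22)
`Step.SFTower.action16` and (0.23) `Step.SFTower.Ek`; no new definition, no new named fact):
* p. 268 [PDF 20], after (2.15), verbatim: *"Finally we perform the coupling constant renormalization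
  1/g_k² = 1/g_{k+1}² + β_{k+1}(g_k) (2.15) with the β-function defined by the formulas (1.20), (1.22) for j = k. The
  equalities (2.12), (2.14) together with the definitions (2.13), (2.15) imply that the action A_{k+1} is given by (1.3)
  with k+1 instead of k."* — `action13_succ`: under (2.15), the form (1.3) at `k+1` equals the form (1.3) at `k` (read at
  the same background field, as in the first line of (2.12): `−(1/g_k²)A(U_{k+1}) + E_k(U_{k+1})`) plus the two new
  brackets of (2.12), `[log Z^{(k)}(U_{k+1}) − log Z^{(k)}(1)]` and — by (2.13), (2.14) `log N″_k = E^{(k+1)}(g_k, 1)` — the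
  bracket `[E^{(k+1)}(g_k, U_{k+1}) − E^{(k+1)}(g_k, 1)]`; and `form13_succ_of_eq212`: hence an action `A_{k+1}` given by
  (2.12) with (2.13), (2.14) substituted IS of the form (1.3) at `k+1` (the field `form13` of `Step.GeneratedBySmallFieldRT`
  at the next index).
* p. 256 [PDF 8], verbatim: *"In the first step the integral (0.17) yields the action A₁ = −(1/g₀²)A^{L⁻¹} + 𝐄^{(1)}, and
  then applying Eq. (0.18) we obtain the representation A₁ = −(1/g₁²)A^{L⁻¹} + [−β₁(g₀)A^{L⁻¹} + 𝐄^{(1)}]. The expression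
  in the square bracket is equal to 𝐄₁. In the second step a new expression of this type is created, in the old only a
  background field is changed. Thus we obtain after k steps 𝐄_k(U_k) = Σ_{j=1}^{k} [−β_j(g_{j−1})A^η(U_k) + 𝐄^{(j)}(U_k)]
  (0.23)."* (superscripts `L⁻¹`, `η` on `A`: see NORMALISATION above — plain `A` below, `d = 4`) — `Ek_succ` (the
  recursion `E_{k+1} = E_k + [−β_{k+1}(g_k)A + E^{(k+1)}]`, definitional) and `action16_succ` (under (0.18)/(0.20) = (2.15):
  `−(1/g_k²)A + E_k + E^{(k+1)} = −(1/g_{k+1}²)A + E_{k+1}`), `action16_one_step` (the printed case `k = 0`), `Ek_zero`,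
  `Ek_at_one` (*"The expression in the square bracket is equal to E₁"*); and the IDENTIFICATION of print's verbatim shape of
  (0.23), `B12.Sum023Printed` (sum over `j = 1, …, k` of `−β_j(g_{j−1})A + E^{(j)}`), with the tower's body `Step.SFTower.Ek`
  (sum over `j < k` of `−β_{j+1}(g_j)A + [E^{(j+1)}(g_j, ·) − E^{(j+1)}(g_j, 1)]`): `sum023Printed_Ek` (index shift; the
  `j`-th printed term `E^{(j)}(U_k)` is the vacuum-subtracted tower term, B12 p. 258 normalization `E^{(j)}(1) = 0`).
* normalization: `wilsonAction_one` (`A^ε(1) = 0`, since `1(∂p) = 1` and `Re tr 1 = 1`), `action13_one`, `action16_one`, `Ek_one` — the forms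
  (1.3), (1.6), (0.23) vanish at the trivial configuration `U ≡ 1`, consistent with the normalization `A_{k+1}(1) = 0` of the
  small-field transformation (B12 (0.19) p. 255: *"the constant N_k is given by the integral above with V = 1"*; tree:
  `SmallFieldStepOp … ∧ A′ 1 = 0`).
The displays (2.12), (2.13) themselves (the Gaussian-integral computation of §2) are NOT reproduced here: they enter
`form13_succ_of_eq212` as the hypothesis `h212` exactly in the substituted shape print uses in the quoted sentence.
-/

namespace Literature.MathematicalPhysics.QuantumFieldTheory.Balaban1983to89.B12Form13Step268

open Literature.MathematicalPhysics.QuantumFieldTheory.Balaban1983to89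
open Step Step.SFTower
open _root_.Finset

section WilsonOne
variable {P : Params} {j : ℕ} {G : Type*} [GaugeGroup G]

/-- `A^ε(1) = Σ_p ε^{d−4}[1 − Re tr 1(∂p)] = 0`: the Wilson action (0.2) vanishes at the trivial configuration `U ≡ 1`
(`1(∂p) = 1` and `Re tr` is normalized by `Re tr 1 = 1`, B12 p. 252). [cite: Balaban1987RG1, (0.2) p.252] -/
theorem wilsonAction_one (w : ℝ) : wilsonAction w (1 : GaugeField P j G) = 0 := by
  have h1 : ∀ p : Plaq P j, GaugeField.plaqHol (1 : GaugeField P j G) p = 1 := fun p => by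
    simp [GaugeField.plaqHol, show ∀ b, (1 : GaugeField P j G) b = 1 from fun _ => rfl]
  simp [wilsonAction, h1, GaugeGroup.reTr_one]

end WilsonOne

section Forms
variable {P : Params} {G : Type*} [GaugeGroup G] {Φ 𝒢 : Type*}

/-- **(0.23) advances by one bracket** (B12 p. 256: *"In the second step a new expression of this type is created, in the
old only a background field is changed. Thus we obtain after k steps (0.23)"*): `E_{k+1}(U) = E_k(U) + [−β_{k+1}(g_k)A(U) +
(E^{(k+1)}(g_k, U) − E^{(k+1)}(g_k, 1))]` (the vacuum subtraction of the tree's (1.6) reading made explicit).  Definitional.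
[cite: Balaban1987RG1, (0.23) p.256] -/
theorem Ek_succ (T : SFTower P G Φ 𝒢) (k : ℕ) (U : GaugeField P 0 G) :
    T.Ek (k+1) U = T.Ek k U
      + ( -(T.flow.β (k+1) (T.flow.g k)) * wilsonAction4 U
          + ((T.Etot (k+1) (T.flow.g k) (T.ofBackground U)).re
              - (T.Etot (k+1) (T.flow.g k) (T.ofBackground 1)).re) ) := by
  simp only [SFTower.Ek, Finset.sum_range_succ]

/-- `E₀ = 0` (no terms before the first step; B12 (0.17): `A₀ = −(1/g₀²)A`). [cite: Balaban1987RG1, (0.17) p.255] -/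
theorem Ek_zero (T : SFTower P G Φ 𝒢) (U : GaugeField P 0 G) : T.Ek 0 U = 0 := by
  simp [SFTower.Ek]

/-- p. 256, verbatim: *"A₁ = −(1/g₁²)A^{L⁻¹} + [−β₁(g₀)A^{L⁻¹} + 𝐄^{(1)}]. The expression in the square bracket is equal
to 𝐄₁."* — `E₁(U) = −β₁(g₀)A(U) + [E^{(1)}(g₀, U) − E^{(1)}(g₀, 1)]` (`A = wilsonAction4`, print's `A^{L⁻¹}` in `d = 4`).
[cite: Balaban1987RG1, (0.23) p.256] -/
theorem Ek_at_one (T : SFTower P G Φ 𝒢) (U : GaugeField P 0 G) :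
    T.Ek 1 U = -(T.flow.β 1 (T.flow.g 0)) * wilsonAction4 U
      + ((T.Etot 1 (T.flow.g 0) (T.ofBackground U)).re - (T.Etot 1 (T.flow.g 0) (T.ofBackground 1)).re) := by
  rw [Ek_succ, Ek_zero, zero_add]

/-- **IDENTIFICATION of print's (0.23) with the tower's `E_k`**: the verbatim shape `B12.Sum023Printed` — *"𝐄_k(U_k) =
Σ_{j=1}^{k} [−β_j(g_{j−1}) A^η(U_k) + 𝐄^{(j)}(U_k)]"* — holds for `Ek := Step.SFTower.Ek T k U`, `A := A(U)`,
`b j := β_j(g_{j−1})` and `Etot j :=` the vacuum-subtracted `j`-th term `E^{(j)}(g_{j−1}, U) − E^{(j)}(g_{j−1}, 1)` (B12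
p. 258: the terms are normalized by `E^{(j)}(1) = 0`, under which the subtraction is print's `E^{(j)}(U_k)` itself); the
tower indexes the same sum by `j − 1 ∈ {0, …, k−1}`. [cite: Balaban1987RG1, (0.23) p.256] -/
theorem sum023Printed_Ek (T : SFTower P G Φ 𝒢) (k : ℕ) (U : GaugeField P 0 G) :
    B12.Sum023Printed (T.Ek k U) (wilsonAction4 U) (fun j => T.flow.β j (T.flow.g (j - 1)))
      (fun j => (T.Etot j (T.flow.g (j - 1)) (T.ofBackground U)).re
        - (T.Etot j (T.flow.g (j - 1)) (T.ofBackground 1)).re) k := by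
  unfold B12.Sum023Printed
  induction k with
  | zero => simp [SFTower.Ek]
  | succ k ih =>
    rw [Finset.sum_Icc_succ_top (by omega), ← ih, Ek_succ]
    simp only [Nat.add_sub_cancel]

/-- **p. 256, the step in the form (0.22) = (1.6)**, verbatim at `k = 0`: *"the integral (0.17) yields the action
A₁ = −(1/g₀²)A^{L⁻¹} + 𝐄^{(1)}, and then applying Eq. (0.18) we obtain the representation A₁ = −(1/g₁²)A^{L⁻¹} +
[−β₁(g₀)A^{L⁻¹} + 𝐄^{(1)}]"* (print's `A^{L⁻¹}` is plain `A = wilsonAction4` here, `d = 4`);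
at general `k`: under the coupling renormalization (0.20) = (2.15) `1/g_k² = 1/g_{k+1}² + β_{k+1}(g_k)`,
`−(1/g_k²)A(U) + E_k(U) + [E^{(k+1)}(g_k, U) − E^{(k+1)}(g_k, 1)] = −(1/g_{k+1}²)A(U) + E_{k+1}(U)`, i.e. the form (1.6) at
`k+1` is the form (1.6) at `k` plus the new term.  Kernel-checked algebra. [cite: Balaban1987RG1, (0.22)–(0.23) p.256] -/
theorem action16_succ (T : SFTower P G Φ 𝒢) (k : ℕ) (U : GaugeField P 0 G)
    (hrg : 1 / (T.flow.g k) ^ 2 = 1 / (T.flow.g (k+1)) ^ 2 + T.flow.β (k+1) (T.flow.g k)) :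
    T.action16 (k+1) U = T.action16 k U
      + ((T.Etot (k+1) (T.flow.g k) (T.ofBackground U)).re
          - (T.Etot (k+1) (T.flow.g k) (T.ofBackground 1)).re) := by
  simp only [SFTower.action16, Finset.sum_range_succ]
  linear_combination (wilsonAction4 U) * hrg

/-- The printed case `k = 0` of p. 256: `A₁ = −(1/g₀²)A^{L⁻¹} + E^{(1)} = −(1/g₁²)A^{L⁻¹} + [−β₁(g₀)A^{L⁻¹} + E^{(1)}]`
under (0.18) `1/g₀² = 1/g₁² + β₁(g₀)` (with the vacuum subtraction explicit; `A^{L⁻¹}` ↦ `wilsonAction4`, `d = 4`).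
[cite: Balaban1987RG1, (0.18) p.255, p.256] -/
theorem action16_one_step (T : SFTower P G Φ 𝒢) (U : GaugeField P 0 G)
    (hrg : 1 / (T.flow.g 0) ^ 2 = 1 / (T.flow.g 1) ^ 2 + T.flow.β 1 (T.flow.g 0)) :
    -(1 / (T.flow.g 0) ^ 2) * wilsonAction4 U
      + ((T.Etot 1 (T.flow.g 0) (T.ofBackground U)).re - (T.Etot 1 (T.flow.g 0) (T.ofBackground 1)).re)
      = T.action16 1 U := by
  have h := action16_succ T 0 U hrg
  have h0 : T.action16 0 U = -(1 / (T.flow.g 0) ^ 2) * wilsonAction4 U := by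
    simp [SFTower.action16]
  rw [h, h0]

/-- **p. 268, the sentence after (2.15)**, verbatim: *"The equalities (2.12), (2.14) together with the definitions (2.13),
(2.15) imply that the action A_{k+1} is given by (1.3) with k+1 instead of k."* — the ALGEBRA: under (2.15)
`1/g_k² = 1/g_{k+1}² + β_{k+1}(g_k)`, the form (1.3) at `k+1` equals the form (1.3) at `k` read at the same background field
(the first line of (2.12): `−(1/g_k²)A(U_{k+1}) + E_k(U_{k+1})`) plus the bracket `[log Z^{(k)}(U_{k+1}) − log Z^{(k)}(1)]` of
(2.12) plus the new term `[E^{(k+1)}(g_k, U_{k+1}) − E^{(k+1)}(g_k, 1)]` ((2.13) with (2.14) `log N″_k = E^{(k+1)}(g_k, 1)`).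
Kernel-checked algebra on `Step.SFTower.action13`. [cite: Balaban1987RG1, (2.12)–(2.15) p.268] -/
theorem action13_succ (T : SFTower P G Φ 𝒢) (k : ℕ) (U : GaugeField P 0 G)
    (hrg : 1 / (T.flow.g k) ^ 2 = 1 / (T.flow.g (k+1)) ^ 2 + T.flow.β (k+1) (T.flow.g k)) :
    T.action13 (k+1) U = T.action13 k U
      + ( (T.logZ k U - T.logZ k 1)
          + ((T.Etot (k+1) (T.flow.g k) (T.ofBackground U)).re
              - (T.Etot (k+1) (T.flow.g k) (T.ofBackground 1)).re) ) := by
  simp only [SFTower.action13, Finset.sum_range_succ]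
  linear_combination (wilsonAction4 U) * hrg

/-- **(1.3) at `k+1` for an action given by (2.12)–(2.15)** (the quoted p. 268 sentence as used downstream: the field
`form13` of `Step.GeneratedBySmallFieldRT` at the next index).  For any parametrization `U` of the background fields
`U_{k+1}(V)` on a domain `dom` and any candidate action `A′ = A_{k+1}`: IF on `dom` the action is given by (2.12) with (2.13)
and (2.14) substituted — `A_{k+1}(V) = [−(1/g_k²)A(U_{k+1}) + E_k(U_{k+1})]₍₁.₃₎ + [log Z^{(k)}(U_{k+1}) − log Z^{(k)}(1)]
+ [E^{(k+1)}(g_k, U_{k+1}) − E^{(k+1)}(g_k, 1)]` — AND (2.15) holds, THEN `A_{k+1}(V)` is given by (1.3) with `k+1` instead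
of `k`. [cite: Balaban1987RG1, (2.12)–(2.15) p.268] -/
theorem form13_succ_of_eq212 (T : SFTower P G Φ 𝒢) (k : ℕ) {X : Type*} (dom : Set X)
    (U : X → GaugeField P 0 G) (A' : X → ℝ)
    (hrg : 1 / (T.flow.g k) ^ 2 = 1 / (T.flow.g (k+1)) ^ 2 + T.flow.β (k+1) (T.flow.g k))
    (h212 : ∀ V ∈ dom, A' V = T.action13 k (U V)
      + ( (T.logZ k (U V) - T.logZ k 1)
          + ((T.Etot (k+1) (T.flow.g k) (T.ofBackground (U V))).re
              - (T.Etot (k+1) (T.flow.g k) (T.ofBackground 1)).re) )) :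
    ∀ V ∈ dom, A' V = T.action13 (k+1) (U V) := by
  intro V hV
  rw [h212 V hV, action13_succ T k (U V) hrg]

/-- The same one-step statement in the form (1.6) = (0.22) (B12 p. 261: *"In many considerations it is not necessary to
separate the terms of zeroth order"*): an action given by `−(1/g_k²)A + E_k + [E^{(k+1)}(g_k, ·) − E^{(k+1)}(g_k, 1)]` under
(2.15) is of the form (1.6) at `k+1`. [cite: Balaban1987RG1, (1.6) p.261, (2.15) p.268] -/
theorem form16_succ_of_step (T : SFTower P G Φ 𝒢) (k : ℕ) {X : Type*} (dom : Set X)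
    (U : X → GaugeField P 0 G) (A' : X → ℝ)
    (hrg : 1 / (T.flow.g k) ^ 2 = 1 / (T.flow.g (k+1)) ^ 2 + T.flow.β (k+1) (T.flow.g k))
    (hstep : ∀ V ∈ dom, A' V = T.action16 k (U V)
      + ((T.Etot (k+1) (T.flow.g k) (T.ofBackground (U V))).re
          - (T.Etot (k+1) (T.flow.g k) (T.ofBackground 1)).re)) :
    ∀ V ∈ dom, A' V = T.action16 (k+1) (U V) := by
  intro V hV
  rw [hstep V hV, action16_succ T k (U V) hrg]

/-- ALONG A FLOW satisfying the renormalization conditions (0.20)/(2.15) up to `K` (`Flow.SatisfiesRG`), the form (1.3)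
advances at every step `k < K`. [cite: Balaban1987RG1, (0.20) p.256, (2.15) p.268] -/
theorem action13_succ_of_satisfiesRG (T : SFTower P G Φ 𝒢) {K : ℕ} (hRG : T.flow.SatisfiesRG K)
    {k : ℕ} (hk : k < K) (U : GaugeField P 0 G) :
    T.action13 (k+1) U = T.action13 k U
      + ( (T.logZ k U - T.logZ k 1)
          + ((T.Etot (k+1) (T.flow.g k) (T.ofBackground U)).re
              - (T.Etot (k+1) (T.flow.g k) (T.ofBackground 1)).re) ) :=
  action13_succ T k U (hRG k hk)

/-! ### Normalization at the trivial configuration -/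

/-- `E_k(1) = 0`: every bracket of (0.23) vanishes at `U ≡ 1` (`A(1) = 0` and the vacuum-subtracted new terms vanish).
[cite: Balaban1987RG1, (0.23) p.256] -/
theorem Ek_one (T : SFTower P G Φ 𝒢) (k : ℕ) : T.Ek k (1 : GaugeField P 0 G) = 0 := by
  simp [SFTower.Ek, wilsonAction4, wilsonAction_one]

/-- `A_k(1) = 0` in the form (1.6) = (0.22): consistent with the normalization *"the constant N_k is given by the integral
above with V = 1"* of (0.19) (tree: `SmallFieldStepOp`, clause `A′ 1 = 0`). [cite: Balaban1987RG1, (0.19) p.255, (0.22) p.256] -/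
theorem action16_one (T : SFTower P G Φ 𝒢) (k : ℕ) : T.action16 k (1 : GaugeField P 0 G) = 0 := by
  rw [SFTower.action16_eq, Ek_one]; simp [wilsonAction4, wilsonAction_one]

/-- `A_k(1) = 0` in the form (1.3): the subtractions `− log Z^{(j)}(1)`, `− E^{(j+1)}(g_j, 1)` of (1.3) and `A(1) = 0` make
every term vanish at `U ≡ 1`. [cite: Balaban1987RG1, (1.3) p.260] -/
theorem action13_one (T : SFTower P G Φ 𝒢) (k : ℕ) : T.action13 k (1 : GaugeField P 0 G) = 0 := by
  simp [SFTower.action13, wilsonAction4, wilsonAction_one]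

end Forms

end Literature.MathematicalPhysics.QuantumFieldTheory.Balaban1983to89.B12Form13Step268
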